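import Summits.CriticalPhenomena.CardyFormulaZ2.Theses.CardyBoundaryCoulombGas
import Literature.Probability.LatticeModels.CorrelationDecay

/-!
# Crux-ideate sketches for `RectilinearCardy` (stmt-CriticalPhenomena-5660), round 1, ideator 1

First lemmas of the two idea cards (they need not be proved here; they must elaborate):

* `QuadrantMarkDensityLaw` — card `quarter-charge-corners`: the convex-corner avatar of the
  route's `HalfPlaneMarkDensityLaw` (crux 5). In the lattice quadrant `ℕ × ℕ` with marks
  `⌊an⌋ < ⌊bn⌋ < ⌊cn⌋` on the `x`-axis and the moving fourth mark `(0, ⌊tn⌋)` on the `y`-axis, the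
  density of "`(0,⌊tn⌋)` is the extreme point of the arc `(c, d)` joined to `[a,b]`" is the
  half-plane pure product pulled back by the explicit uniformizing map `w = z²`
  (marks `a², b², c²`, moving point `-t²`, Jacobian `|dw/dt| = 2t`): the factor `2t` is the
  convex-corner factor `|w'|^{h}`, `h = h(-2) = 1`, i.e. the corner charge `-1/4` at work.
* `WedgeAngleLaw` — card `ctm-fractional-powers`: the value-free wedge law for the one-arm
  event at the three lattice angles `π/2, π, 3π/2` (`θ · x(θ) = const`), the spectral shadow of
  "corner geometries of angle `kπ/2` are `k`-fold contractions of one quadrant transfer tensor".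
-/

namespace Summit.CriticalPhenomena.CardyFormulaZ2.Cruxes.RectilinearCardy.IdeatorOne

open Filter MeasureTheory
open Literature.Probability.Percolation Literature.Probability.LatticeModels
open Literature.Probability.RandomPlanarGeometry

/-- The lattice quadrant `{v | 0 ≤ v 0 ∧ 0 ≤ v 1} ⊆ ℤ²` (one convex corner at the origin). -/
def quadrant : Set (Site 2) := {v | 0 ≤ v 0 ∧ 0 ≤ v 1}

/-- Card `quarter-charge-corners`, first lemma (convex-corner avatar of crux 5
`HalfPlaneMarkDensityLaw`): for `0 < a < b < c` and `0 < t`, with `A = [⌊an⌋,⌊bn⌋] × {0}`, moving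
mark `d = (0, ⌊tn⌋)` and the arc `(c d) = {(s,0) : s ≥ ⌊cn⌋} ∪ {(0,s) : s ≥ ⌊tn⌋}` of the quadrant,
`n · P_{1/2}[ d ↔ A in the quadrant, and no other vertex of (c d) ↔ A ]` converges to the
`w = z²` pull-back of the half-plane pure product:
`(cardyConst/3) · ((b²-a²)(c²-b²)(c²-a²))^{1/3} · ((t²+a²)(t²+b²)(t²+c²))^{-2/3} · 2t`. -/
def QuadrantMarkDensityLaw : Prop :=
  ∀ a b c t : ℝ, 0 < a → a < b → b < c → 0 < t →
    Tendsto
      (fun n : ℕ ↦ (n : ℝ) *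
        (bondPercolation (zdGraph 2) half).real
          (openCrossing quadrant {v : Site 2 | v 1 = 0 ∧ ⌊a * n⌋ ≤ v 0 ∧ v 0 ≤ ⌊b * n⌋}
              {![0, ⌊t * n⌋]} \
            openCrossing quadrant {v : Site 2 | v 1 = 0 ∧ ⌊a * n⌋ ≤ v 0 ∧ v 0 ≤ ⌊b * n⌋}
              ({v : Site 2 | v 1 = 0 ∧ ⌊c * n⌋ ≤ v 0} ∪ {v : Site 2 | v 0 = 0 ∧ ⌊t * n⌋ < v 1})))
      atTop
      (nhds (cardyConst / 3 * ((b ^ 2 - a ^ 2) * (c ^ 2 - b ^ 2) * (c ^ 2 - a ^ 2)) ^ (1 / 3 : ℝ) *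
        ((t ^ 2 + a ^ 2) * (t ^ 2 + b ^ 2) * (t ^ 2 + c ^ 2)) ^ (-(2 / 3) : ℝ) * (2 * t)))

/-- One-arm probability from the apex `0` to sup-distance `n` inside the lattice wedge `W ∩ [-n,n]²`. -/
noncomputable def wedgeOneArm (W : Set (Site 2)) (n : ℕ) : ℝ :=
  (bondPercolation (zdGraph 2) half).real
    {ω | ∃ y : Site 2, (y 0 = (n : ℤ) ∨ y 0 = -(n : ℤ) ∨ y 1 = (n : ℤ) ∨ y 1 = -(n : ℤ)) ∧
      ω ∈ openConnIn {v : Site 2 | v ∈ W ∧ -(n : ℤ) ≤ v 0 ∧ v 0 ≤ n ∧ -(n : ℤ) ≤ v 1 ∧ v 1 ≤ n} 0 y}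

/-- The lattice half-plane (angle `π`), quadrant (angle `π/2`) and three-quarter plane
(angle `3π/2`, one reflex corner) with apex `0`. -/
def halfPlane : Set (Site 2) := {v | 0 ≤ v 1}

/-- See `halfPlane`. -/
def threeQuarterPlane : Set (Site 2) := {v | 0 ≤ v 0 ∨ 0 ≤ v 1}

/-- Card `ctm-fractional-powers`, first lemma (value-free wedge law, `θ · x(θ)` constant over the
three lattice angles): the one-arm decay exponents from the apex of the half-plane, the quadrant
and the three-quarter plane exist and are `e`, `2e`, `2e/3` for ONE real `e` (conformally
`e = 1/3`, the route's crux 6 `HalfPlaneOneArmThird`; here no value is asserted). The reflex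
angle `3π/2` is the polygon datum no folding argument reaches. -/
def WedgeAngleLaw : Prop :=
  ∃ e : ℝ, HasDecayExponent (wedgeOneArm halfPlane) e ∧
    HasDecayExponent (wedgeOneArm quadrant) (2 * e) ∧
    HasDecayExponent (wedgeOneArm threeQuarterPlane) (2 * e / 3)

/-- Sanity link: the route's crux 6 pins the value `e = 1/3` in `WedgeAngleLaw`'s half-plane
conjunct (same event up to the redundant clause `y 1 = -n`, which is vacuous on the half-plane
box). Stated, not proved. -/
def WedgeAngleLawValues : Prop :=
  HasDecayExponent (wedgeOneArm quadrant) (2 / 3) ∧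
    HasDecayExponent (wedgeOneArm threeQuarterPlane) (2 / 9)

end Summit.CriticalPhenomena.CardyFormulaZ2.Cruxes.RectilinearCardy.IdeatorOne
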